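import Literature.Analysis.FluidPDE.ESSLocalHolderBlowupFarFieldBound
import Literature.Analysis.FluidPDE.NSLocalLerayFarFieldRegularSlabProofs
import HarnessLib

/-!
# ESS 2003, Thm. 1.4 — tools for the blow-up limit: distributional solutions below the top time,
# and smooth representatives of locally bounded solutions

Analysis/FluidPDE proofs file (theorems only; no definitions, no named facts) on the discharge
path of `Literature.Analysis.FluidPDE.ess_local_holder` (L. Escauriaza, G. Seregin, V. Šverák,
*`L_{3,∞}`-solutions of Navier–Stokes equations and backward uniqueness*, Russ. Math. Surveys
58:2 (2003) 211–250, Thm. 1.4, proof in §3). The blow-up limit `(w, π)` of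
`ESSLocalHolderBlowupLimit.exists_blowup_limit` is a suitable weak solution in every cylinder
`Q(a) = ]-a², 0[ × B(0, a)`; ESS §3 then works on unbounded regions below the top time (the
far field `]-T, 0[ × {|x| > R}`, (3.26)–(3.30), and the strips around regular times, (3.33)),
where the solution is essentially bounded and hence smooth in space (the regularity theory of
bounded solutions, here the named fact `NSBoundedHigherRegularityBounds`, Seregin–Šverák 2009,
§2 p. 8, taken as a hypothesis). This file supplies the two bookkeeping steps:

* `exists_subset_parabolicCylinder_of_isBounded`, `isDistributionalNSSolutionOn_of_forall_cylinder`
  — a pair solving the system in the sense of distributions in every `Q(a)` solves it on every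
  open `Ω ⊆ ]-∞, 0[ × ℝ³` (test fields have compact support in some `Q(a)`);
* `exists_smooth_representative_of_locally_bounded` — from `NSBoundedHigherRegularityBounds`:
  if around every point of `Ω = ]a, b[ × S` the pair is a distributional solution, essentially
  bounded by `M`, with `∫∫|π|^{3/2} ≤ P`, on the covering cylinder `Q((min(t + ρ², b), x), 2ρ)`,
  then `w` has a representative on `Ω` with `C^∞` slices, jointly continuous spatial
  derivatives, and `‖D_xⁿ U‖ ≤ K` (`n ≤ N`) — the gluing of Lemarié-Rieusset 2016, proof of
  Thm. 15.4, Step 2 (the tree's `exists_farField_representative_unit`), for a general field.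

## References

* L. Escauriaza, G. Seregin, V. Šverák, Russ. Math. Surveys 58:2 (2003) 211–250, §3,
  (3.26)–(3.33). [`EscauriazaSereginSverak2003`]
* G. Seregin, V. Šverák, Comm. PDE 34 (2009) = arXiv:0804.1803, §2 p. 8. [`SereginSverak2009`]
* P. G. Lemarié-Rieusset, *The Navier–Stokes Problem in the 21st Century* (2016), proof of
  Thm. 15.4, Step 2 (PDF p. 569). [`LemarieRieusset2016`]
-/

noncomputable section

open MeasureTheory TopologicalSpace Set Function Filter Metric
open _root_.Topology
open scoped ENNReal NNReal InnerProductSpace RealInnerProductSpace Laplacian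

namespace Literature.Analysis.FluidPDE


section Sheaf


/-- A bounded set of space–time points with negative times lies in some backward cylinder
`Q(a) = ]-a², 0[ × B(0, a)` hanging from the origin. [folklore] -/
theorem exists_subset_parabolicCylinder_of_isBounded {K : Set (ℝ × (EuclideanSpace ℝ (Fin 3)))}
    (hK : Bornology.IsBounded K) (hsub : K ⊆ Iio (0 : ℝ) ×ˢ (univ : Set (EuclideanSpace ℝ (Fin 3)))) :
    ∃ a : ℝ, 0 < a ∧ K ⊆ parabolicCylinder a (0 : ℝ × (EuclideanSpace ℝ (Fin 3))) := by
  obtain ⟨R, hR⟩ := hK.subset_closedBall (0 : ℝ × (EuclideanSpace ℝ (Fin 3)))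
  set R' : ℝ := max R 0 with hR'
  refine ⟨R' + 1, by positivity, fun z hz => ?_⟩
  have hzR : ‖z‖ ≤ R' := by
    have h := hR hz
    rw [mem_closedBall, dist_zero_right] at h
    exact h.trans (le_max_left _ _)
  have h1 : |z.1| ≤ R' := (norm_fst_le z).trans hzR
  have h2 : ‖z.2‖ ≤ R' := (norm_snd_le z).trans hzR
  have ht : z.1 < 0 := (hsub hz).1
  rw [mem_parabolicCylinder]
  refine ⟨⟨?_, by simpa using ht⟩, ?_⟩
  · show (0 : ℝ × (EuclideanSpace ℝ (Fin 3))).1 - (R' + 1) ^ 2 < z.1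
    rw [Prod.fst_zero]
    have h3 : -R' ≤ z.1 := by linarith [(abs_le.1 h1).1]
    nlinarith [le_max_right R 0]
  · show dist z.2 (0 : ℝ × (EuclideanSpace ℝ (Fin 3))).2 < R' + 1
    rw [Prod.snd_zero, dist_zero_right]
    linarith

/-- **Distributional solutions glue along the exhaustion by the cylinders `Q(a)`.** If `(w, π)`
solves the Navier–Stokes system (`ν = 1`, no force) in the sense of distributions in every
cylinder `Q(a) = ]-a², 0[ × B(0, a)`, `a > 0`, then it does so on every open region
`Ω ⊆ ]-∞, 0[ × ℝ³` (local integrability is local; a test field on `Ω` has compact support in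
some `Q(a)`, is a test field on `Ω ∩ Q(a)`, and the two integrals agree since the integrand
vanishes off the support). [folklore] -/
theorem isDistributionalNSSolutionOn_of_forall_cylinder {w : ℝ → (EuclideanSpace ℝ (Fin 3)) → (EuclideanSpace ℝ (Fin 3))} {π : ℝ → (EuclideanSpace ℝ (Fin 3)) → ℝ}
    (hw : ∀ a : ℝ, 0 < a →
      IsDistributionalNSSolutionOn (parabolicCylinderOpens a (0 : ℝ × (EuclideanSpace ℝ (Fin 3)))) 1 0 w π)
    {Ω : Set (ℝ × (EuclideanSpace ℝ (Fin 3)))} (hΩ : IsOpen Ω) (hΩsub : Ω ⊆ Iio (0 : ℝ) ×ˢ (univ : Set (EuclideanSpace ℝ (Fin 3)))) :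
    IsDistributionalNSSolutionOn ⟨Ω, hΩ⟩ 1 0 w π := by
  -- local integrability is local
  have hLI : ∀ {F : ℝ × (EuclideanSpace ℝ (Fin 3)) → (EuclideanSpace ℝ (Fin 3))} , (∀ a : ℝ, 0 < a →
      LocallyIntegrableOn F (parabolicCylinder a (0 : ℝ × (EuclideanSpace ℝ (Fin 3)))) volume) →
      LocallyIntegrableOn F Ω volume := by
    intro F hF z hz
    obtain ⟨a, ha, hza⟩ := exists_subset_parabolicCylinder_of_isBounded
      (Bornology.isBounded_singleton (x := z)) (singleton_subset_iff.2 (hΩsub hz))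
    have hzQ : z ∈ parabolicCylinder a (0 : ℝ × (EuclideanSpace ℝ (Fin 3))) := hza (mem_singleton z)
    have h := hF a ha z hzQ
    rw [(isOpen_parabolicCylinder a _).nhdsWithin_eq hzQ] at h
    exact h.filter_mono nhdsWithin_le_nhds
  have hLI' : ∀ {F : ℝ × (EuclideanSpace ℝ (Fin 3)) → ℝ} , (∀ a : ℝ, 0 < a →
      LocallyIntegrableOn F (parabolicCylinder a (0 : ℝ × (EuclideanSpace ℝ (Fin 3)))) volume) →
      LocallyIntegrableOn F Ω volume := by
    intro F hF z hz
    obtain ⟨a, ha, hza⟩ := exists_subset_parabolicCylinder_of_isBounded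
      (Bornology.isBounded_singleton (x := z)) (singleton_subset_iff.2 (hΩsub hz))
    have hzQ : z ∈ parabolicCylinder a (0 : ℝ × (EuclideanSpace ℝ (Fin 3))) := hza (mem_singleton z)
    have h := hF a ha z hzQ
    rw [(isOpen_parabolicCylinder a _).nhdsWithin_eq hzQ] at h
    exact h.filter_mono nhdsWithin_le_nhds
  refine ⟨hLI fun a ha => (hw a ha).1, hLI' fun a ha => (hw a ha).2.1,
    hLI' fun a ha => (hw a ha).2.2.1, fun θ hθ => ?_, fun ψ hψ => ?_⟩
  · -- the divergence constraint
    obtain ⟨a, ha, hKa⟩ := exists_subset_parabolicCylinder_of_isBounded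
      hθ.hasCompactSupport.isCompact.isBounded (hθ.tsupport_subset.trans hΩsub)
    set Q' : Opens (ℝ × (EuclideanSpace ℝ (Fin 3))) := ⟨Ω, hΩ⟩ ⊓ parabolicCylinderOpens a (0 : ℝ × (EuclideanSpace ℝ (Fin 3))) with hQ'
    have hθ' : IsSpaceTimeTestOn Q' θ :=
      ⟨hθ.contDiff, hθ.hasCompactSupport, subset_inter hθ.tsupport_subset hKa⟩
    have key := ((hw a ha).of_le inf_le_right).2.2.2.1 θ hθ'
    have hsub : ((Q' : Opens (ℝ × (EuclideanSpace ℝ (Fin 3)))) : Set (ℝ × (EuclideanSpace ℝ (Fin 3)))) ⊆ Ω := inter_subset_left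
    show ∫ z in Ω, _ = 0
    rw [setIntegral_eq_of_subset_of_forall_sdiff_eq_zero hΩ.measurableSet hsub]
    · exact key
    · rintro ⟨t, x⟩ hz
      have hg : gradient (θ t) x = 0 := by
        rw [gradient, hθ'.fderiv_slice_eq_zero hz.2, map_zero]
      simp [hg]
  · -- the momentum equation
    obtain ⟨a, ha, hKa⟩ := exists_subset_parabolicCylinder_of_isBounded
      hψ.hasCompactSupport.isCompact.isBounded (hψ.tsupport_subset.trans hΩsub)
    set Q' : Opens (ℝ × (EuclideanSpace ℝ (Fin 3))) := ⟨Ω, hΩ⟩ ⊓ parabolicCylinderOpens a (0 : ℝ × (EuclideanSpace ℝ (Fin 3))) with hQ'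
    have hψ' : IsSpaceTimeTestOn Q' ψ :=
      ⟨hψ.contDiff, hψ.hasCompactSupport, subset_inter hψ.tsupport_subset hKa⟩
    have key := ((hw a ha).of_le inf_le_right).2.2.2.2 ψ hψ'
    have hsub : ((Q' : Opens (ℝ × (EuclideanSpace ℝ (Fin 3)))) : Set (ℝ × (EuclideanSpace ℝ (Fin 3)))) ⊆ Ω := inter_subset_left
    show ∫ z in Ω, _ = 0
    rw [setIntegral_eq_of_subset_of_forall_sdiff_eq_zero hΩ.measurableSet hsub]
    · exact key
    · rintro ⟨t, x⟩ hz
      have h1 : deriv (fun s => ψ s x) t = 0 := hψ'.deriv_eq_zero hz.2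
      have h2 : fderiv ℝ (ψ t) x = 0 := hψ'.fderiv_slice_eq_zero hz.2
      have h3 : Δ (ψ t) x = 0 := hψ'.laplacian_slice_eq_zero hz.2
      have h4 : ψ t x = 0 := hψ'.apply_eq_zero hz.2
      have h5 : VectorCalculus.divergence (ψ t) x = 0 := by simp [VectorCalculus.divergence, h2]
      simp [h1, convect, h2, h3, h4, h5]

end Sheaf



section Representative


/-- **Smooth representative with uniform derivative bounds, from local boundedness** (the gluing
step of Lemarié-Rieusset 2016, proof of Thm. 15.4, Step 2, for a general field; Serrin's local
regularity in the quantitative form `NSBoundedHigherRegularityBounds`). Let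
`Ω = ]a, b[ × S` (`S` open) and `ρ > 0`. Suppose that for every `(t, x) ∈ Ω` the pair `(w, π)`
solves the Navier–Stokes system (`ν = 1`, no force) in the sense of distributions in the
backward cylinder `Q((t', x), 2ρ)`, `t' = min(t + ρ², b)`, with `|w| ≤ M` a.e. and
`∫∫ |π|^{3/2} ≤ P` there. Then `w` has a representative `U` on `Ω` which is jointly continuous,
has `C^∞` slices at the points of `Ω`, all of whose spatial derivatives `(t, x) ↦ D_xⁿU(t, x)`
are jointly continuous on `Ω`, with `‖D_xⁿU‖ ≤ K` on `Ω` for `n ≤ N`; `K` depends on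
`ρ, M, P, N` through `NSBoundedHigherRegularityBounds` only. Proof: the local representatives on
the inner cylinders `Q((t', x), 3ρ/2) ∋ (t, x)` obey one bound
(`NSBoundedHigherRegularityBounds.exists_uniform_bound`); glue them
(`exists_continuousOn_ae_eq_of_locally`) and transfer the properties along the open overlaps
(`Measure.eqOn_open_of_ae_eq`). [cite: LemarieRieusset2016, proof of Thm. 15.4, Step 2 (PDF p. 569)] -/
theorem exists_smooth_representative_of_locally_bounded (hB : NSBoundedHigherRegularityBounds)
    {w : ℝ → (EuclideanSpace ℝ (Fin 3)) → (EuclideanSpace ℝ (Fin 3))} {π : ℝ → (EuclideanSpace ℝ (Fin 3)) → ℝ} {a b : ℝ} {S : Set (EuclideanSpace ℝ (Fin 3))} (hS : IsOpen S)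
    {ρ M : ℝ} {P : ℝ≥0} (hρ : 0 < ρ)
    (hloc : ∀ z ∈ Ioo a b ×ˢ S,
      IsDistributionalNSSolutionOn (parabolicCylinderOpens (2 * ρ) (min (z.1 + ρ ^ 2) b, z.2)) 1 0 w π ∧
      (∀ᵐ q ∂(volume.restrict (parabolicCylinder (2 * ρ) (min (z.1 + ρ ^ 2) b, z.2))),
        ‖w q.1 q.2‖ ≤ M) ∧
      ∫⁻ q in parabolicCylinder (2 * ρ) (min (z.1 + ρ ^ 2) b, z.2), ‖π q.1 q.2‖ₑ ^ (3 / 2 : ℝ) ≤ P)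
    (N : ℕ) :
    ∃ (K : ℝ) (U : ℝ → (EuclideanSpace ℝ (Fin 3)) → (EuclideanSpace ℝ (Fin 3))),
      uncurry U =ᵐ[volume.restrict (Ioo a b ×ˢ S)] uncurry w ∧
      ContinuousOn (uncurry U) (Ioo a b ×ˢ S) ∧
      (∀ z ∈ Ioo a b ×ˢ S, ContDiffAt ℝ (⊤ : ℕ∞) (U z.1) z.2) ∧
      (∀ n : ℕ, ContinuousOn (fun z : ℝ × (EuclideanSpace ℝ (Fin 3)) => iteratedFDeriv ℝ n (U z.1) z.2) (Ioo a b ×ˢ S)) ∧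
      ∀ n ≤ N, ∀ z ∈ Ioo a b ×ˢ S, ‖iteratedFDeriv ℝ n (U z.1) z.2‖ ≤ K := by
  set Ω : Set (ℝ × (EuclideanSpace ℝ (Fin 3))) := Ioo a b ×ˢ S with hΩ
  have hΩo : IsOpen Ω := isOpen_Ioo.prod hS
  have hr : (3 / 2 * ρ) ∈ Ioo 0 (2 * ρ) := ⟨by positivity, by linarith⟩
  obtain ⟨K₀, hK₀⟩ := hB.exists_uniform_bound (2 * ρ) M P hr N
  -- Step 1: local smooth representatives with the uniform bound
  have hloc' : ∀ z ∈ Ω, ∃ Tz : Set (ℝ × (EuclideanSpace ℝ (Fin 3))), IsOpen Tz ∧ z ∈ Tz ∧ Tz ⊆ Ω ∧ ∃ V : ℝ → (EuclideanSpace ℝ (Fin 3)) → (EuclideanSpace ℝ (Fin 3)),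
      uncurry w =ᵐ[volume.restrict Tz] uncurry V ∧ ContinuousOn (uncurry V) Tz ∧
      (∀ z' ∈ Tz, ContDiffAt ℝ (⊤ : ℕ∞) (V z'.1) z'.2) ∧
      (∀ n : ℕ, ContinuousOn (fun z' : ℝ × (EuclideanSpace ℝ (Fin 3)) => iteratedFDeriv ℝ n (V z'.1) z'.2) Tz) ∧
      ∀ n ≤ N, ∀ z' ∈ Tz, ‖iteratedFDeriv ℝ n (V z'.1) z'.2‖ ≤ K₀ := by
    rintro ⟨t, x⟩ ⟨ht, hx⟩
    set z₀ : ℝ × (EuclideanSpace ℝ (Fin 3)) := (min (t + ρ ^ 2) b, x) with hz₀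
    obtain ⟨hsol, hbd, hP⟩ := hloc (t, x) ⟨ht, hx⟩
    obtain ⟨V, hae, hVc, hCD, hHol, hbdV⟩ := hK₀ w π z₀ hsol hbd hP
    have hsub : parabolicCylinder (3 / 2 * ρ) z₀ ⊆ parabolicCylinder (2 * ρ) z₀ := by
      intro q hq
      rw [mem_parabolicCylinder] at hq ⊢
      exact ⟨⟨by nlinarith [hq.1.1], hq.1.2⟩, hq.2.trans (by linarith)⟩
    refine ⟨parabolicCylinder (3 / 2 * ρ) z₀ ∩ Ω, (isOpen_parabolicCylinder _ _).inter hΩo,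
      ⟨mem_parabolicCylinder_top hρ ht.2, ht, hx⟩, inter_subset_right, V,
      ae_restrict_of_ae_restrict_of_subset (inter_subset_left.trans hsub) hae,
      hVc.mono (inter_subset_left.trans hsub), fun z' hz' => hCD z' (hsub hz'.1),
      fun n => ?_, fun n hn z' hz' => hbdV n hn z' hz'.1⟩
    obtain ⟨C, α, hα, hH⟩ := hHol n (3 / 2 * ρ) hr
    exact (hH.continuousOn hα).mono inter_subset_left
  -- Step 2: glue
  have hloc'' : ∀ z ∈ Ω, ∃ Tz : Set (ℝ × (EuclideanSpace ℝ (Fin 3))), IsOpen Tz ∧ z ∈ Tz ∧ Tz ⊆ Ω ∧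
      ∃ g : ℝ × (EuclideanSpace ℝ (Fin 3)) → (EuclideanSpace ℝ (Fin 3)), ContinuousOn g Tz ∧ uncurry w =ᵐ[volume.restrict Tz] g := by
    intro z hz
    obtain ⟨Tz, hTo, hzT, hTΩ, V, hae, hVc, -⟩ := hloc' z hz
    exact ⟨Tz, hTo, hzT, hTΩ, uncurry V, hVc, hae⟩
  obtain ⟨g, hg, hug⟩ := exists_continuousOn_ae_eq_of_locally (μ := volume) hloc''
  -- Step 3: the glued field agrees with the local representatives on their neighbourhoods
  have hagree : ∀ {Tz : Set (ℝ × (EuclideanSpace ℝ (Fin 3)))} {V : ℝ → (EuclideanSpace ℝ (Fin 3)) → (EuclideanSpace ℝ (Fin 3))}, IsOpen Tz → Tz ⊆ Ω →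
      uncurry w =ᵐ[volume.restrict Tz] uncurry V → ContinuousOn (uncurry V) Tz →
      EqOn (uncurry (curry g)) (uncurry V) Tz := by
    intro Tz V hTo hTΩ hae hVc
    have h1 : uncurry (curry g) =ᵐ[volume.restrict Tz] uncurry V := by
      have h3 : uncurry w =ᵐ[volume.restrict Tz] g := ae_restrict_of_ae_restrict_of_subset hTΩ hug
      simpa using h3.symm.trans hae
    refine Measure.eqOn_open_of_ae_eq h1 hTo ?_ hVc
    simpa using hg.mono hTΩ
  refine ⟨K₀, curry g, ?_, ?_, fun z hz => ?_, fun n z hz => ?_, fun n hn z hz => ?_⟩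
  · simpa using hug.symm
  · simpa using hg
  · obtain ⟨Tz, hTo, hzT, hTΩ, V, hae, hVc, hCD, -⟩ := hloc' z hz
    exact contDiffAt_of_eqOn hTo (hagree hTo hTΩ hae hVc) hzT (hCD z hzT)
  · obtain ⟨Tz, hTo, hzT, hTΩ, V, hae, hVc, -, hjc, -⟩ := hloc' z hz
    have heq := hagree hTo hTΩ hae hVc
    have h1 : ContinuousOn (fun z' : ℝ × (EuclideanSpace ℝ (Fin 3)) => iteratedFDeriv ℝ n (curry g z'.1) z'.2) Tz :=
      (hjc n).congr fun z' hz' => iteratedFDeriv_slice_eq_of_eqOn hTo heq n hz'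
    exact (h1.continuousAt (hTo.mem_nhds hzT)).continuousWithinAt
  · obtain ⟨Tz, hTo, hzT, hTΩ, V, hae, hVc, -, -, hbdV⟩ := hloc' z hz
    rw [iteratedFDeriv_slice_eq_of_eqOn hTo (hagree hTo hTΩ hae hVc) n hzT]
    exact hbdV n hn z hzT

end Representative

end Literature.Analysis.FluidPDE
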